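import Summits.ResolutionOfSingularities.ResolutionOfSingularities.Theorems.HilbertSamuelEliminationSigmaMaxModificationsCorridor3WLadderMovingRows
import Mathlib.CategoryTheory.CofilteredSystem
import Mathlib.CategoryTheory.Functor.OfSequence
import HarnessLib

/-!
# [OURS · L1 W4.2] The STRATA-half `Wlow3CharStrataM` (G1′, «interruptions lemma») of the MOVING W-ladder:
# its COMBINATORIAL SPINE, PROVED — Kőnig on the lineages of stratum components through the chain points

Crux chain w42 (`SigmaMaxModifications`, stmt-ResolutionOfSingularities-18506; registered skeleton `w_ladder` v5 on
`SigmaMaxModificationsCorridor3`, stmt-ResolutionOfSingularities-19249), CHAIN v3.7 SEAT TABLE row «stub-4 successor →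
`Moving.Wlow3CharStrataM p` (G1′ moving, interruptions lemma; with idea-2's (a)–(d))», seat res-L1-w42-stub-4 (gen 3).
OURS (cell res-hironaka, slot W4.2); NOT statements of H. Hironaka's manuscript [Hironaka2017] nor of
[CossartJannsenSaito2020]; AI-drafted, weaker than expert review. Every `theorem` below is PROVED; the open content sits in
the two `def … : Prop` rows of §3. Helper file `--supports stmt-ResolutionOfSingularities-19249`.

## What the row says and how the paper argument (idea-2 card F v3 §(4), tri-1 TRIAGE v3 R3-F′ (P2) / R3-B2) proves it

`Moving.Wlow3CharStrataM p` (module `…Corridor3WLadderMovingDefs` §MD.2): along `S(X, ν)` from a maximal origin `x ∈ X(ν)` of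
characteristic `p` at level `3` in the (F1) regime there is NO infinite MOVING chain of closed near points `x_n ∈ X_n(ν)` which
at EVERY stage has `ē_{x_n}(X_n) ≤ 2` and is NOT isolated in the Hilbert–Samuel locus of `X_n`. The argument («technique B at
generic points»): at every stage some positive-dimensional irreducible component of `X_n(ν)` passes through `x_n`; follow these
components from stage to stage — a component `Z'` of `X_{n+1}(ν)` through `x_{n+1}` either DOMINATES a component
`Z = closure π(Z')` of `X_n(ν)` (then `x_n ∈ Z`: a LINEAGE continues; this is exactly the inheritance clause of CJS's labels,
tree `Labelling.next`) or it does not (a BIRTH through the chain point: near lines `ℙ(Dir x_n)` at point blow-ups of `x_n`,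
dominating curves over non-component curves inside surface components during the replay of a surface resolution);
(b) births through the chain points happen at FINITELY MANY stages (Thm. 3.14 at the closed chain points: no birth at a curve
step, none at a surface step — which kills the chain —, point steps at a non-isolated chain point are replay steps of the FIRST
resolution cycle of one of the finitely many labels alive when the tail starts); (c) NO LINEAGE IS INFINITE (label
bookkeeping: the least treated label is eventually constant, so some lineage through the chain points is blown up as part of
the centre at infinitely many cycle ends; at its generic point `η` this is an infinite sequence of closed-point blow-ups with
near points of the excellent local ring `𝒪_{X_n,η}` of dimension `≤ 2`, `e_η ≤ e_{x_n} − 1 ≤ 1` by CJS Thm. 3.6 — excluded by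
CJS Cor. 6.37 / Thm. 6.35 in EVERY characteristic); and then (KŐNIG) finitely many components per stage + (b) + «never
isolated» force an infinite lineage, contradicting (c).

## What this file proves (namespace `…Theorems.SigmaMaxModificationsCorridor3.Moving`)

* §0 `exists_section_of_finite_nonempty` — Kőnig's lemma for an `ℕ`-indexed inverse system of non-empty finite types
  (Mathlib `nonempty_sections_of_finite_inverse_system` on `Functor.ofOpSequence`).
* §1 `StepProjection R N ν s s' f` — «`f : X_{n+1} ⟶ X_n` IS the blow-down of the canonical near step `s → s'`» (the step
  data of `CanonicalNearStep` with the projection transported to the ACTUAL stages `s'.W ⟶ s.W`, so that functions along a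
  chain `c : ℕ → MarkedStage` can be composed without dependent casts); every canonical near step has one
  (`CanonicalNearStep.exists_stepProjection`), it is unique for a functional oracle (`StepProjection.unique`), and it maps the
  marked point to the marked point (`StepProjection.base_pt`).
* §2 `componentsThrough N ν s` — the irreducible components of `X_n(ν)` through the marked point; finitely many on a Noetherian
  stage (`componentsThrough_finite`), non-empty as soon as `x_n ∈ X_n(ν)` (`componentsThrough_nonempty`); every stage reached
  from a maximal origin is Noetherian (`isNoetherian_of_reaches_init`: finite type over the ground field, blow-ups proper).
* §3 the two OURS rows `StrataBirthsSettle p N Q G` ((b): along the chain, from some stage on every component through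
  `x_{n+1}` dominates a component of `X_n(ν)`) and `StrataLineagesFinite p N Q G` ((c): no infinite dominating lineage of
  components through the chain points) — for an ARBITRARY origin predicate `Q` and grade `G` (so the β-row's strata-half,
  `Q = ¬QCharRegime ∧ QPerfectResidueField`, is served by the same theorem) — and the PROVED reduction
  `maxOriginNoMovingNearChainAtQ_notIso_of_lineages : StrataBirthsSettle p N Q G → StrataLineagesFinite p N Q G →
  MaxOriginNoMovingNearChainAtQ p N Q (fun s => G s ∧ ¬ Iso N s)`, specialised BY NAME to
  `wlow3CharStrataM_of_lineages : … → Wlow3CharStrataM p` and to the regime-free `wlowStrataM_of_lineages : … → WlowStrataM p`.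

So the strata-half is reduced to (b) and (c), each a statement about ONE step presentation at a time plus label bookkeeping;
the finiteness-per-stage, non-emptiness and Kőnig layers are discharged here once and for all. NOTHING geometric is claimed:
(b) and (c) stay OPEN rows (their docstrings name the printed inputs). Honest limits: the rows quantify over chains that are
never isolated in `X_max`; for such chains `{x_n}` is never a component of `X_n(ν)` once `ν` is maximal on `X_n` (permissible
centres), so the lineages of (c) are positive-dimensional there — this file does not need or prove that remark.

References: CJS LNM 2270 Rem. 6.29 (1) (labels: «dominates ⇒ inherits»), Thm. 3.6, Thm. 3.14, Prop. 6.31, Thm. 6.35, Cor. 6.37,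
p. 105, p. 107 [CossartJannsenSaito2020]; D. Kőnig 1927 / Mathlib `CategoryTheory.CofilteredSystem`; tree
`…CampaignW42Tertiary` (`MarkedStage`, `CanonicalNearStep`, `IsBlownUp`, `NoMovingNearChainFrom`), `…CampaignW42NearChain`
(`IsMaximalOrigin`), `…Corridor3WLadderMovingDefs` (`Iso`, `MaxOriginNoMovingNearChainAtQ`, `Wlow3CharStrataM`, `WlowStrataM`),
`Literature…AlterationsNormalFormBlowupParts` (`componentsIn`). HOME/L/w42/CHAIN.md v3.7 §0f; L/res-L1-w42-tri-1/TRIAGE.md v3 §R3.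
-/

noncomputable section

-- plan-1/idea-2 module setting kept (namespace `…Corridor3.Moving` re-enters `…Corridor3`)
set_option linter.dupNamespace false

open CategoryTheory AlgebraicGeometry TopologicalSpace Topology
open Summit.ResolutionOfSingularities.ResolutionOfSingularities.Theorems.CampaignW42
open Literature.AlgebraicGeometry.Resolution Literature.RingTheory.HilbertSamuel
open Literature.AlgebraicGeometry.CossartJannsenSaito2020
open Summit.ResolutionOfSingularities.ResolutionOfSingularities.Theorems.SigmaMaxModificationsCorridor3

namespace Summit.ResolutionOfSingularities.ResolutionOfSingularities.Theorems.SigmaMaxModificationsCorridor3.Moving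

universe u v

/-! ## §0. Kőnig's lemma for sequences -/

/-- **Kőnig's lemma, `ℕ`-indexed inverse systems**: a sequence of non-empty finite types with maps `F (n+1) → F n` has a
coherent section. [folklore] -/
theorem exists_section_of_finite_nonempty {F : ℕ → Type v} [∀ n, Finite (F n)] [∀ n, Nonempty (F n)]
    (f : ∀ n, F (n + 1) → F n) : ∃ u : ∀ n, F n, ∀ n, f n (u (n + 1)) = u n := by
  let G : ℕᵒᵖ ⥤ Type v := Functor.ofOpSequence (X := F) fun n => TypeCat.ofHom (f n)
  haveI : ∀ j : ℕᵒᵖ, Finite (G.obj j) := fun j => by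
    obtain ⟨j⟩ := j
    exact (inferInstance : Finite (F j))
  haveI : ∀ j : ℕᵒᵖ, Nonempty (G.obj j) := fun j => by
    obtain ⟨j⟩ := j
    exact (inferInstance : Nonempty (F j))
  obtain ⟨u, hu⟩ := nonempty_sections_of_finite_inverse_system G
  refine ⟨fun n => u ⟨n⟩, fun n => ?_⟩
  have := hu (homOfLE (Nat.le_add_right n 1)).op
  rw [Functor.ofOpSequence_map_homOfLE_succ] at this
  exact this

variable {R : ∀ S : Scheme.{u}, CentreSeq S → Prop} {N : ℕ} {ν : ℕ → ℕ}

/-! ## §1. Step projections: the blow-down of a canonical near step as a morphism of the actual stages -/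

/-- [OURS · L1 W4.2] **`f : X_{n+1} ⟶ X_n` is THE BLOW-DOWN of the canonical near step `s → s'`**: there are step data
`(C, P', x')` as in `CanonicalNearStep` — the canonical centre `C` from the state of `s`, the next cycle state `P'`, the closed
near point `x' ∈ Bl_C(X_n)(ν)` over `x_n` — with `s' = (Bl_C(X_n), labels updated, P', x')`, and `f` is `π_C` read on the
stage `s'.W` (transported along that equality). OURS bookkeeping; NOT a statement of the manuscript. [folklore] -/
def StepProjection (R : ∀ S : Scheme.{u}, CentreSeq S → Prop) (N : ℕ) (ν : ℕ → ℕ) (s s' : MarkedStage.{u})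
    (f : s'.W ⟶ s.W) : Prop :=
  ∃ (C : s.W.IdealSheafData) (P' : Option (Pending (blowup C))) (h : IsLocallyNoetherian (blowup C))
    (x' : ↥(blowup C)),
    IsCanonicalStep R N ν s.L s.P C P' ∧ (blowup.π C).base x' = s.pt ∧
      IsClosed ({x'} : Set ↥(blowup C)) ∧ x' ∈ Scheme.hsStratum (blowup C) N ν ∧
      ∃ e : s' = ⟨blowup C, h, s.L.next (Scheme.hsStratum s.W N ν) C, P', x'⟩,
        f = eqToHom (congrArg MarkedStage.W e) ≫ blowup.π C

/-- Every canonical near step has a step projection. [folklore] -/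
theorem _root_.Summit.ResolutionOfSingularities.ResolutionOfSingularities.Theorems.CampaignW42.CanonicalNearStep.exists_stepProjection
    {s s' : MarkedStage.{u}} (h : CanonicalNearStep R N ν s s') :
    ∃ f : s'.W ⟶ s.W, StepProjection R N ν s s' f := by
  obtain ⟨C, P', hln, x', hcs, hπ, hcl, hx', rfl⟩ := h
  exact ⟨blowup.π C, C, P', hln, x', hcs, hπ, hcl, hx', rfl, by simp⟩

namespace StepProjection

variable {s s' : MarkedStage.{u}} {f g : s'.W ⟶ s.W}

/-- A step projection presents a canonical near step. [folklore] -/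
theorem canonicalNearStep (hf : StepProjection R N ν s s' f) : CanonicalNearStep R N ν s s' := by
  obtain ⟨C, P', hln, x', hcs, hπ, hcl, hx', e, -⟩ := hf
  exact ⟨C, P', hln, x', hcs, hπ, hcl, hx', e⟩

/-- **The step projection maps the marked point to the marked point** (`x_{n+1} ↦ x_n`). [folklore] -/
theorem base_pt (hf : StepProjection R N ν s s' f) : f.base s'.pt = s.pt := by
  obtain ⟨C, P', hln, x', -, hπ, -, -, e, rfl⟩ := hf
  subst e
  simpa using hπ

/-- The marked point of the target lies in the `ν`-stratum. [folklore] -/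
theorem pt_mem_hsStratum (hf : StepProjection R N ν s s' f) : s'.pt ∈ Scheme.hsStratum s'.W N ν :=
  hf.canonicalNearStep.pt_mem_hsStratum

/-- **For a functional oracle the step projection is unique** (the canonical centre is unique,
`IsCanonicalStep.centre_unique`). [cite: CossartJannsenSaito2020, Rem. 6.29 (1)] -/
theorem unique (hRf : OracleFunctional R) (hf : StepProjection R N ν s s' f) (hg : StepProjection R N ν s s' g) :
    f = g := by
  obtain ⟨C₁, P₁, h₁, x₁, hcs₁, -, -, -, e₁, rfl⟩ := hf
  obtain ⟨C₂, P₂, h₂, x₂, hcs₂, -, -, -, e₂, rfl⟩ := hg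
  obtain rfl : C₁ = C₂ := hcs₁.centre_unique hRf hcs₂
  rfl

end StepProjection

/-! ## §2. Components of the stratum through the marked point; Noetherian stages -/

/-- [OURS · L1 W4.2] The irreducible components of the `ν`-stratum `X_n(ν)` of the stage which pass through the marked point
`x_n` (tree `componentsIn`). OURS bookkeeping. [folklore] -/
def componentsThrough (N : ℕ) (ν : ℕ → ℕ) (s : MarkedStage.{u}) : Set (Set s.W) :=
  {Z | Z ∈ componentsIn (Scheme.hsStratum s.W N ν) ∧ s.pt ∈ Z}

/-- Unfolding. [folklore] -/
theorem mem_componentsThrough_iff {s : MarkedStage.{u}} {Z : Set s.W} :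
    Z ∈ componentsThrough N ν s ↔ Z ∈ componentsIn (Scheme.hsStratum s.W N ν) ∧ s.pt ∈ Z := Iff.rfl

/-- On a Noetherian stage only finitely many components pass through the marked point. [folklore] -/
theorem componentsThrough_finite (s : MarkedStage.{u}) [IsNoetherian s.W] : (componentsThrough N ν s).Finite :=
  (componentsIn.finite _).subset fun _ h => h.1

/-- If the marked point lies in the stratum, some component passes through it. [folklore] -/
theorem componentsThrough_nonempty {s : MarkedStage.{u}} (h : s.pt ∈ Scheme.hsStratum s.W N ν) :
    (componentsThrough N ν s).Nonempty := by
  obtain ⟨E, hE, hx⟩ := componentsIn.exists_mem h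
  exact ⟨E, hE, hx⟩

/-- **Domination continues a lineage through the chain points**: if the image-closure of a component through `x_{n+1}` under
the step projection is a component of `X_n(ν)`, it passes through `x_n`. [cite: CossartJannsenSaito2020, Rem. 6.29 (1)] -/
theorem closure_image_mem_componentsThrough {s s' : MarkedStage.{u}} {f : s'.W ⟶ s.W} (hf : StepProjection R N ν s s' f)
    {Z' : Set s'.W} (hZ' : Z' ∈ componentsThrough N ν s')
    (hdom : closure (f.base '' Z') ∈ componentsIn (Scheme.hsStratum s.W N ν)) :
    closure (f.base '' Z') ∈ componentsThrough N ν s :=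
  ⟨hdom, subset_closure ⟨s'.pt, hZ'.2, hf.base_pt⟩⟩

/-- Along `Reaches` from the initial marked stage of a point of `X(ν)`, the marked point stays in the `ν`-stratum. [folklore] -/
theorem pt_mem_hsStratum_of_reaches {X : Scheme.{u}} [IsLocallyNoetherian X] {x : X} (hx : x ∈ Scheme.hsStratum X N ν)
    {s : MarkedStage.{u}} (hr : Reaches R N ν (MarkedStage.init X x) s) : s.pt ∈ Scheme.hsStratum s.W N ν := by
  induction hr with
  | refl => exact hx
  | tail _ hlast _ => exact hlast.pt_mem_hsStratum

/-- Finite type over a field propagates along a canonical near step (blow-ups of locally Noetherian schemes are proper).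
[cite: GortzWedhorn2020, Prop. 13.96 (1)] -/
theorem exists_overField_of_canonicalNearStep {k : Type u} [Field k] {s s' : MarkedStage.{u}}
    (h : ∃ f : s.W ⟶ Spec (.of k), LocallyOfFiniteType f ∧ QuasiCompact f) (hst : CanonicalNearStep R N ν s s') :
    ∃ f : s'.W ⟶ Spec (.of k), LocallyOfFiniteType f ∧ QuasiCompact f := by
  obtain ⟨C, P', hln, x', -, -, -, -, rfl⟩ := hst
  obtain ⟨f, hf, hq⟩ := h
  haveI := s.ln
  haveI : IsProper (blowup.π C) := (blowup.isBlowup C).isProper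
  exact ⟨blowup.π C ≫ f, inferInstance, inferInstance⟩

/-- … and along `Reaches`. [folklore] -/
theorem exists_overField_of_reaches {k : Type u} [Field k] {s s' : MarkedStage.{u}}
    (h : ∃ f : s.W ⟶ Spec (.of k), LocallyOfFiniteType f ∧ QuasiCompact f) (hr : Reaches R N ν s s') :
    ∃ f : s'.W ⟶ Spec (.of k), LocallyOfFiniteType f ∧ QuasiCompact f := by
  induction hr with
  | refl => exact h
  | tail _ hlast ih => exact exists_overField_of_canonicalNearStep ih hlast

/-- **Every stage reached from a maximal origin is a Noetherian scheme** (finite type over the ground field).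
[cite: GortzWedhorn2020, Prop. 13.96 (1)] -/
theorem isNoetherian_of_reaches_init {p : ℕ} {X : Scheme.{u}} [IsLocallyNoetherian X] {x : X}
    (hX : IsMaximalOrigin p N ν X x) {s : MarkedStage.{u}} (hr : Reaches R N ν (MarkedStage.init X x) s) :
    IsNoetherian s.W := by
  obtain ⟨k, _, _, f, -, hft, hqc⟩ := hX.exists_structure
  obtain ⟨g, hg, hq⟩ := exists_overField_of_reaches (k := k) (s := MarkedStage.init X x) ⟨f, hft, hqc⟩ hr
  exact Scheme.isNoetherian_of_finiteType_over_field g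

/-! ## §3. The two rows (b), (c) and the PROVED reduction of the strata-half -/

/-- [OURS · L1 W4.2] **ROW (b) — BIRTHS THROUGH THE CHAIN POINTS SETTLE.** For every functional admissible oracle, value `ν`,
maximal origin `x ∈ X(ν)` of characteristic `p` at level `N` satisfying `Q`, and every MOVING chain of canonical near steps
`x_n ∈ X_n(ν)` from it inside the grade `G` which is NEVER isolated in `(X_n)_max`: from some stage `n₁` on, every irreducible
component of `X_{n+1}(ν)` through `x_{n+1}` DOMINATES an irreducible component of `X_n(ν)` — the closure of its image under the
blow-down is a component (the inheritance clause of CJS's labels; no component through the chain point is newborn any more).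
Printed inputs of the intended proof (`G = (ē ≤ 2)`): Thm. 3.14 at the closed chain points (near points over `x_n ∈ D` lie on
`ℙ(Dir_{x_n}/T_{x_n}D)`: no birth at curve steps, no near point at surface steps), and Rem. 6.29 (1) (point blow-ups at a
non-isolated chain point are replay steps of a FIRST resolution cycle; finitely many labels are alive when the tail starts).
OURS row, OPEN; NOT a statement of the manuscript. [cite: CossartJannsenSaito2020, Thm. 3.14, Rem. 6.29 (1), Prop. 6.31] -/
def StrataBirthsSettle (p N : ℕ) (Q : ℕ → (ℕ → ℕ) → ∀ X : Scheme.{u}, X → Prop) (G : MarkedStage.{u} → Prop) : Prop :=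
  ∀ (R : ∀ S : Scheme.{u}, CentreSeq S → Prop), OracleFunctional R → OracleAdmissible R →
  ∀ (ν : ℕ → ℕ) (X : Scheme.{u}) [IsLocallyNoetherian X] (x : X), IsMaximalOrigin p N ν X x → Q N ν X x →
  ∀ c : ℕ → MarkedStage.{u}, Reaches R N ν (MarkedStage.init X x) (c 0) →
    (∀ n, CanonicalNearStep R N ν (c n) (c (n + 1))) → (∀ n, G (c n)) → (∀ n, ¬ Iso N (c n)) →
    (∀ n, ∃ m, n ≤ m ∧ (c m).IsBlownUp R N ν) →
    ∃ n₁, ∀ n, n₁ ≤ n → ∀ f : (c (n + 1)).W ⟶ (c n).W, StepProjection R N ν (c n) (c (n + 1)) f →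
      ∀ Z' ∈ componentsThrough N ν (c (n + 1)),
        closure (f.base '' Z') ∈ componentsIn (Scheme.hsStratum (c n).W N ν)

/-- [OURS · L1 W4.2] **ROW (c) — NO INFINITE LINEAGE THROUGH THE CHAIN POINTS.** In the same scope (moving, never isolated,
grade `G`, `Q`-origin): there is no sequence `Z_n` of irreducible components of `X_n(ν)` through `x_n` with `Z_{n+1}` DOMINATING
`Z_n` for every `n` (`closure π(Z_{n+1}) = Z_n`). Printed inputs of the intended proof (`G = (ē ≤ 2)`): Rem. 6.29 (1) (the least
treated label is eventually constant, so some lineage through the chain points lies in the centre at infinitely many cycle ends),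
Thm. 3.6 (`e_{η_Z} ≤ e_{x_n} − 1 ≤ 1` at the generic point of a permissible `Z ∋ x_n`), Prop. 6.31 (localisation at `η_Z`) and
Cor. 6.37 / Thm. 6.35 for the excellent local ring `𝒪_{X_n,η_Z}` of dimension `≤ 2` — a theorem in EVERY characteristic there.
OURS row, OPEN; NOT a statement of the manuscript. [cite: CossartJannsenSaito2020, Rem. 6.29 (1), Thm. 3.6, Prop. 6.31, Cor. 6.37] -/
def StrataLineagesFinite (p N : ℕ) (Q : ℕ → (ℕ → ℕ) → ∀ X : Scheme.{u}, X → Prop) (G : MarkedStage.{u} → Prop) : Prop :=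
  ∀ (R : ∀ S : Scheme.{u}, CentreSeq S → Prop), OracleFunctional R → OracleAdmissible R →
  ∀ (ν : ℕ → ℕ) (X : Scheme.{u}) [IsLocallyNoetherian X] (x : X), IsMaximalOrigin p N ν X x → Q N ν X x →
  ∀ c : ℕ → MarkedStage.{u}, Reaches R N ν (MarkedStage.init X x) (c 0) →
    (∀ n, CanonicalNearStep R N ν (c n) (c (n + 1))) → (∀ n, G (c n)) → (∀ n, ¬ Iso N (c n)) →
    (∀ n, ∃ m, n ≤ m ∧ (c m).IsBlownUp R N ν) →
    ¬ ∃ Z : ∀ n, Set (c n).W, (∀ n, Z n ∈ componentsThrough N ν (c n)) ∧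
        ∀ n, ∃ f : (c (n + 1)).W ⟶ (c n).W, StepProjection R N ν (c n) (c (n + 1)) f ∧
          closure (f.base '' Z (n + 1)) = Z n

/-- **THE STRATA-HALF REDUCED TO (b) AND (c) — PROVED (Kőnig on the lineages through the chain points).** For any origin
predicate `Q` and grade `G`: rows (b) `StrataBirthsSettle` and (c) `StrataLineagesFinite` give «no MOVING, NEVER-ISOLATED `G`-chain
from a `Q`-maximal origin». Proof: shift the chain past the stage `n₁` of (b); the components of `X_n(ν)` through `x_n` form
non-empty (`x_n ∈ X_n(ν)`) finite (Noetherian stages) sets mapped into each other by `Z' ↦ closure π(Z')` thanks to (b); Kőnig's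
lemma yields an infinite dominating lineage, which (c) forbids. [cite: CossartJannsenSaito2020, Rem. 6.29 (1), p. 105] -/
theorem maxOriginNoMovingNearChainAtQ_notIso_of_lineages {p N : ℕ} {Q : ℕ → (ℕ → ℕ) → ∀ X : Scheme.{u}, X → Prop}
    {G : MarkedStage.{u} → Prop} (hB : StrataBirthsSettle p N Q G) (hC : StrataLineagesFinite p N Q G) :
    MaxOriginNoMovingNearChainAtQ p N Q fun s => G s ∧ ¬ Iso N s := by
  intro R hRf hRa ν X _ x hX hQ
  rintro ⟨c, h0, hstep, hG, hmov⟩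
  obtain ⟨n₁, hn₁⟩ := hB R hRf hRa ν X x hX hQ c h0 hstep (fun n => (hG n).1) (fun n => (hG n).2) hmov
  -- the tail of the chain from stage `n₁`
  let c' : ℕ → MarkedStage.{u} := fun n => c (n₁ + n)
  have h0' : Reaches R N ν (MarkedStage.init X x) (c' 0) := reaches_chain h0 hstep n₁
  have hstep' : ∀ n, CanonicalNearStep R N ν (c' n) (c' (n + 1)) := fun n => hstep (n₁ + n)
  have hN : ∀ n, IsNoetherian (c' n).W := fun n => isNoetherian_of_reaches_init hX (reaches_chain h0' hstep' n)
  -- the step projections along the tail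
  have hproj : ∀ n, ∃ f : (c' (n + 1)).W ⟶ (c' n).W, StepProjection R N ν (c' n) (c' (n + 1)) f :=
    fun n => (hstep' n).exists_stepProjection
  choose f hf using hproj
  -- on the tail every component through the chain point dominates one through the previous chain point
  have hdom : ∀ n, ∀ Z' ∈ componentsThrough N ν (c' (n + 1)),
      closure ((f n).base '' Z') ∈ componentsThrough N ν (c' n) := fun n Z' hZ' =>
    closure_image_mem_componentsThrough (hf n) hZ' (hn₁ (n₁ + n) (Nat.le_add_right _ _) (f n) (hf n) Z' hZ')
  -- Kőnig on the finite non-empty sets of components through the chain points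
  let F : ℕ → Type u := fun n => ↥(componentsThrough N ν (c' n))
  haveI : ∀ n, Finite (F n) := fun n => by
    haveI := hN n
    exact (componentsThrough_finite (N := N) (ν := ν) (c' n)).to_subtype
  haveI : ∀ n, Nonempty (F n) := fun n =>
    (componentsThrough_nonempty
      (pt_mem_hsStratum_of_reaches hX.mem_stratum (reaches_chain h0' hstep' n))).to_subtype
  obtain ⟨u, hu⟩ := exists_section_of_finite_nonempty (F := F)
    fun n Z' => ⟨closure ((f n).base '' Z'.1), hdom n Z'.1 Z'.2⟩
  exact hC R hRf hRa ν X x hX hQ c' h0' hstep' (fun n => (hG _).1) (fun n => (hG _).2) (io_shift hmov n₁)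
    ⟨fun n => (u n).1, fun n => (u n).2, fun n => ⟨f n, hf n, congrArg Subtype.val (hu n)⟩⟩

/-- **`Wlow3CharStrataM p` (G1′ in the (F1) regime, the strata-half of the registered `stub_Wlow3M_char`) FROM ROWS (b) AND (c)**
at `N = 3`, `Q = QCharRegime p`, `G = (ē ≤ 2)` — by name. [cite: CossartJannsenSaito2020, Thm. 6.35, Prop. 6.31] -/
theorem wlow3CharStrataM_of_lineages {p : ℕ}
    (hB : StrataBirthsSettle.{0} p 3 (Helpers.QCharRegime p) fun s => s.geomDirDim ≤ 2)
    (hC : StrataLineagesFinite.{0} p 3 (Helpers.QCharRegime p) fun s => s.geomDirDim ≤ 2) :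
    Wlow3CharStrataM p :=
  maxOriginNoMovingNearChainAtQ_notIso_of_lineages hB hC

/-- The unrestricted moving row is the `Q = ⊤` case of the `Q`-restricted one. [folklore] -/
theorem maxOriginNoMovingNearChainAt_of_atQ_true {p N : ℕ} {G : MarkedStage.{u} → Prop}
    (h : MaxOriginNoMovingNearChainAtQ p N (fun _ _ _ _ => True) G) : MaxOriginNoMovingNearChainAt p N G :=
  fun R hRf hRa ν X _ x hX => h R hRf hRa ν X x hX trivial

/-- **`WlowStrataM p` (G1′ without regime restriction, §3a of the module) FROM ROWS (b) AND (c)** at `N = 3`, `Q = ⊤`,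
`G = (ē ≤ 2)`. [cite: CossartJannsenSaito2020, Thm. 6.35, Prop. 6.31] -/
theorem wlowStrataM_of_lineages {p : ℕ}
    (hB : StrataBirthsSettle.{0} p 3 (fun _ _ _ _ => True) fun s => s.geomDirDim ≤ 2)
    (hC : StrataLineagesFinite.{0} p 3 (fun _ _ _ _ => True) fun s => s.geomDirDim ≤ 2) :
    WlowStrataM p :=
  maxOriginNoMovingNearChainAt_of_atQ_true (maxOriginNoMovingNearChainAtQ_notIso_of_lineages hB hC)

/-- **`Wlow3CharM p` ASSEMBLED with the strata-half discharged to (b) ∧ (c)**: the registered row `stub_Wlow3M_char` follows from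
the print-faithful F-key `KeyTheorem640_char_isolated`, the two units-half pieces of the module (`IsoLowDirDimTerminatesM`,
`UnitTowerExtractionQM`) and rows (b), (c) (module `wlow3CharM_assembled`). [cite: CossartJannsenSaito2020, Thm. 6.40, Cor. 6.37, Thm. 6.35] -/
theorem wlow3CharM_of_extraction_of_lineages {p : ℕ} (hK : KeyTheorem640_char_isolated.{0})
    (hlow : IsoLowDirDimTerminatesM p) (hext : UnitTowerExtractionQM p)
    (hB : StrataBirthsSettle.{0} p 3 (Helpers.QCharRegime p) fun s => s.geomDirDim ≤ 2)
    (hC : StrataLineagesFinite.{0} p 3 (Helpers.QCharRegime p) fun s => s.geomDirDim ≤ 2) : Wlow3CharM.{0} p :=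
  wlow3CharM_assembled hK hlow hext (wlow3CharStrataM_of_lineages hB hC)

end Summit.ResolutionOfSingularities.ResolutionOfSingularities.Theorems.SigmaMaxModificationsCorridor3.Moving

end
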